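import Mathlib

/-!
# Toolkit C — finite-dimensional subspaces of `ℂ[X]` under multiplication by `X` ((P1), (P2))

Support file for crux item `stmt-MatrixMultiplication-10752`
(`Summit.MatrixMultiplication.MatrixMultiplication.Theses.HiddenToeplitzCorners.HiddenCornerLemmaR`),
line `frobenius-dual-short-syzygies`, stub group TOOLKIT-C of the strip theorem / `stub_gconstDualLaw`
(paper proof: `math/STRIP_THEOREM.md` §1, (P1)–(P2)).

For a finite-dimensional subspace `S ≤ ℂ[X]` write `X S := map (mulLeft X) S`.
* `hclR_not_X_mul_stable` **(P1)**: if `S ≠ 0` then `X S ≰ S` (an element of maximal degree is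
  pushed out of `S`).
* `hclR_X_mul_growth_one` **(P2)**: if `dim (S + X S) = dim S + 1` then `S = g • degreeLT (dim S)`
  for some `g ≠ 0` (namely an element of minimal degree).  Proof: with `t ∈ S` of maximal degree
  `d`, `S + X S = S ⊕ ℂ (X t)` by dimension count, and comparing degrees shows `X b ∈ S` whenever
  `b ∈ S` has `deg (X b) ≤ d` (`hclR_X_mul_mem_of_degree_lt`); hence `g, X g, …, X^m g ∈ S` for
  `g` of minimal degree `d - m`, so `g • degreeLT (m+1) ≤ S`, while
  `dim S ≤ dim degreeLT (d+1) - dim degreeLT (d-m) = m + 1` because `S ∩ degreeLT (d-m) = 0`.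
Helpers: `hclR_mem_degreeLT_iff_natDegree_lt`, `hclR_exists_le_degreeLT`,
`hclR_exists_max_degree`, `hclR_exists_min_degree`, `hclR_finrank_degreeLT`.
Pure Mathlib polynomial algebra (folklore).
-/

set_option linter.dupNamespace false

namespace Summit.MatrixMultiplication.MatrixMultiplication.Theorems

open Polynomial

/-- A nonzero polynomial lies in `degreeLT n` iff its `natDegree` is `< n`. -/
theorem hclR_mem_degreeLT_iff_natDegree_lt {p : ℂ[X]} (hp : p ≠ 0) {n : ℕ} :
    p ∈ Polynomial.degreeLT ℂ n ↔ p.natDegree < n :=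
  Polynomial.mem_degreeLT.trans (Polynomial.natDegree_lt_iff_degree_lt hp).symm

/-- `degreeLT ℂ n` is finite-dimensional, of dimension `n`. -/
theorem hclR_finrank_degreeLT (n : ℕ) :
    FiniteDimensional ℂ ↥(Polynomial.degreeLT ℂ n) ∧
      Module.finrank ℂ ↥(Polynomial.degreeLT ℂ n) = n :=
  ⟨Module.Finite.equiv (Polynomial.degreeLTEquiv ℂ n).symm,
    by rw [(Polynomial.degreeLTEquiv ℂ n).finrank_eq, Module.finrank_fin_fun]⟩

/-- A finite-dimensional subspace of `ℂ[X]` sits inside some `degreeLT n`. -/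
theorem hclR_exists_le_degreeLT (S : Submodule ℂ ℂ[X]) [FiniteDimensional ℂ S] :
    ∃ n : ℕ, S ≤ Polynomial.degreeLT ℂ n := by
  obtain ⟨s, hs⟩ := (Submodule.FG.of_finite : S.FG)
  obtain ⟨n, hn⟩ := Polynomial.span_of_finite_le_degreeLT (R := ℂ) s.finite_toSet
  rw [hs] at hn
  exact ⟨n, hn⟩

/-- Maximal degree: a nonzero finite-dimensional `S ≤ ℂ[X]` lies in `degreeLT (d+1)` but contains
some `t ∉ degreeLT d` (so `t` has degree exactly `d`, the maximal degree in `S`). -/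
theorem hclR_exists_max_degree (S : Submodule ℂ ℂ[X]) [FiniteDimensional ℂ S] (hS : S ≠ ⊥) :
    ∃ d : ℕ, S ≤ Polynomial.degreeLT ℂ (d + 1) ∧ ∃ t ∈ S, t ∉ Polynomial.degreeLT ℂ d := by
  classical
  have hex : ∃ n : ℕ, S ≤ Polynomial.degreeLT ℂ n := hclR_exists_le_degreeLT S
  have h0 : ¬ S ≤ Polynomial.degreeLT ℂ 0 := by
    intro hle
    apply hS
    rw [eq_bot_iff]
    intro p hp
    rw [Submodule.mem_bot]
    by_contra hp0
    have := (hclR_mem_degreeLT_iff_natDegree_lt hp0).mp (hle hp)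
    omega
  have hne : Nat.find hex ≠ 0 := by
    intro h
    have := Nat.find_spec hex
    rw [h] at this
    exact h0 this
  obtain ⟨d, hd⟩ := Nat.exists_eq_succ_of_ne_zero hne
  refine ⟨d, ?_, ?_⟩
  · have := Nat.find_spec hex
    rwa [hd] at this
  · have hmin : ¬ S ≤ Polynomial.degreeLT ℂ d := Nat.find_min hex (by omega)
    exact SetLike.not_le_iff_exists.mp hmin

/-- Minimal degree: a nonzero subspace `S ≤ ℂ[X]` contains a nonzero `g` whose `natDegree` is
minimal among the nonzero elements of `S`. -/
theorem hclR_exists_min_degree (S : Submodule ℂ ℂ[X]) (hS : S ≠ ⊥) :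
    ∃ g ∈ S, g ≠ 0 ∧ ∀ p ∈ S, p ≠ 0 → g.natDegree ≤ p.natDegree := by
  classical
  obtain ⟨p, hp, hp0⟩ := (Submodule.ne_bot_iff S).mp hS
  have hex : ∃ d : ℕ, ∃ q ∈ S, q ≠ 0 ∧ q.natDegree = d := ⟨_, p, hp, hp0, rfl⟩
  obtain ⟨g, hg, hg0, hgd⟩ := Nat.find_spec hex
  refine ⟨g, hg, hg0, fun q hq hq0 => ?_⟩
  rw [hgd]
  exact Nat.find_min' hex ⟨q, hq, hq0, rfl⟩

-- The registered signature (kept verbatim) names the binders `e`, `hS`, which the statement itself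
-- does not reference; silence the unused-variable linter on these binders only.
set_option linter.unusedVariables false in
/-- **(P1)**: a nonzero finite-dimensional subspace of `ℂ[X]` is not stable under `p ↦ X * p`
(an element of maximal degree `d` would be sent to degree `d + 1`).  The frame `e` is not used. -/
theorem hclR_not_X_mul_stable : ∀ {r : ℕ} (e : Fin r → Polynomial ℂ) (S : Submodule ℂ (Polynomial ℂ)) [FiniteDimensional ℂ S] (hS : S ≠ ⊥), ¬ Submodule.map (LinearMap.mulLeft ℂ (Polynomial.X : Polynomial ℂ) : Polynomial ℂ →ₗ[ℂ] Polynomial ℂ) S ≤ S := by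
  intro _r _e S _ hS hle
  obtain ⟨d, hSd, t, ht, htd⟩ := hclR_exists_max_degree S hS
  have ht0 : t ≠ 0 := by
    rintro rfl
    exact htd (zero_mem _)
  have h1 := mt (hclR_mem_degreeLT_iff_natDegree_lt ht0).mpr htd
  have hXt : X * t ∈ S := hle ⟨t, ht, rfl⟩
  have h2 := (hclR_mem_degreeLT_iff_natDegree_lt (mul_ne_zero X_ne_zero ht0)).mp (hSd hXt)
  rw [natDegree_X_mul ht0] at h2
  omega

/-- Key degree-comparison step for (P2).  If `dim (S + X S) = dim S + 1`, `S ≤ degreeLT (d+1)` and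
`t ∈ S` has degree `d`, then `S + X S = S ⊕ ℂ (X t)` (dimension count), and consequently every
`b ∈ S` with `deg (X b) ≤ d` satisfies `X b ∈ S`: writing `X b = y + c • X t` with `y ∈ S`,
degrees force `c = 0`. -/
theorem hclR_X_mul_mem_of_degree_lt (S : Submodule ℂ ℂ[X]) [FiniteDimensional ℂ S]
    (h : Module.finrank ℂ ↥(S ⊔ Submodule.map (LinearMap.mulLeft ℂ (X : ℂ[X])) S) =
      Module.finrank ℂ S + 1)
    {d : ℕ} (hSd : S ≤ Polynomial.degreeLT ℂ (d + 1)) {t : ℂ[X]} (ht : t ∈ S)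
    (htd : t ∉ Polynomial.degreeLT ℂ d) {b : ℂ[X]} (hb : b ∈ S)
    (hXb : X * b ∈ Polynomial.degreeLT ℂ (d + 1)) : X * b ∈ S := by
  have ht0 : t ≠ 0 := by
    rintro rfl
    exact htd (zero_mem _)
  have htdeg : t.natDegree = d := by
    have h1 := (hclR_mem_degreeLT_iff_natDegree_lt ht0).mp (hSd ht)
    have h2 := mt (hclR_mem_degreeLT_iff_natDegree_lt ht0).mpr htd
    omega
  have hXt0 : X * t ≠ 0 := mul_ne_zero X_ne_zero ht0
  have hXtdeg : (X * t).natDegree = d + 1 := by rw [natDegree_X_mul ht0, htdeg]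
  -- `X t ∉ S`, so `S < S + ℂ (X t) ≤ S + X S`, and the dimension hypothesis forces equality.
  have hXt : X * t ∉ S := fun hmem => by
    have := (hclR_mem_degreeLT_iff_natDegree_lt hXt0).mp (hSd hmem)
    omega
  have hXtT : X * t ∈ Submodule.map (LinearMap.mulLeft ℂ (X : ℂ[X])) S := ⟨t, ht, rfl⟩
  have hUT : S ⊔ (ℂ ∙ (X * t)) ≤ S ⊔ Submodule.map (LinearMap.mulLeft ℂ (X : ℂ[X])) S :=
    sup_le_sup_left ((Submodule.span_singleton_le_iff_mem _ _).mpr hXtT) _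
  have hSU : S < S ⊔ (ℂ ∙ (X * t)) :=
    SetLike.lt_iff_le_and_exists.mpr
      ⟨le_sup_left, X * t, Submodule.mem_sup_right (Submodule.mem_span_singleton_self _), hXt⟩
  have h1 := Submodule.finrank_lt_finrank_of_lt hSU
  have h2 := Submodule.finrank_mono hUT
  have hUT' : S ⊔ (ℂ ∙ (X * t)) = S ⊔ Submodule.map (LinearMap.mulLeft ℂ (X : ℂ[X])) S :=
    Submodule.eq_of_le_of_finrank_eq hUT (by omega)
  have hXbU : X * b ∈ S ⊔ (ℂ ∙ (X * t)) := by
    rw [hUT']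
    exact Submodule.mem_sup_right ⟨b, hb, rfl⟩
  obtain ⟨y, hy, z, hz, hyz⟩ := Submodule.mem_sup.mp hXbU
  obtain ⟨c, rfl⟩ := Submodule.mem_span_singleton.mp hz
  by_cases hc : c = 0
  · subst hc
    rw [zero_smul, add_zero] at hyz
    rw [← hyz]
    exact hy
  · exfalso
    have h3 : c • (X * t) ∈ Polynomial.degreeLT ℂ (d + 1) := by
      have hcs : c • (X * t) = X * b - y := by rw [← hyz]; abel
      rw [hcs]
      exact sub_mem hXb (hSd hy)
    have hmem : X * t ∈ Polynomial.degreeLT ℂ (d + 1) := by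
      have := Submodule.smul_mem _ c⁻¹ h3
      rwa [smul_smul, inv_mul_cancel₀ hc, one_smul] at this
    have := (hclR_mem_degreeLT_iff_natDegree_lt hXt0).mp hmem
    omega

-- As for (P1): the registered signature names binders (`e`, `hS`, `h`) the statement does not reference.
set_option linter.unusedVariables false in
/-- **(P2)** structure lemma: if `S ≠ 0` is finite-dimensional with `dim (S + X S) = dim S + 1`, then
`S = g • degreeLT (dim S)` for some `g ≠ 0` (an element of `S` of minimal degree).
The frame `e` is not used. -/
theorem hclR_X_mul_growth_one : ∀ {r : ℕ} (e : Fin r → Polynomial ℂ) (S : Submodule ℂ (Polynomial ℂ)) [FiniteDimensional ℂ S] (hS : S ≠ ⊥) (h : Module.finrank ℂ ↥(S ⊔ Submodule.map (LinearMap.mulLeft ℂ (Polynomial.X : Polynomial ℂ) : Polynomial ℂ →ₗ[ℂ] Polynomial ℂ) S) = Module.finrank ℂ S + 1), ∃ g : (Polynomial ℂ), g ≠ 0 ∧ S = Submodule.map (LinearMap.mulLeft ℂ g) (Polynomial.degreeLT ℂ (Module.finrank ℂ S)) := by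
  intro _r _e S _ hS h
  classical
  obtain ⟨d, hSd, t, ht, htd⟩ := hclR_exists_max_degree S hS
  obtain ⟨g, hg, hg0, hmin⟩ := hclR_exists_min_degree S hS
  have hgd : g.natDegree ≤ d := by
    have := (hclR_mem_degreeLT_iff_natDegree_lt hg0).mp (hSd hg)
    omega
  obtain ⟨m, hm⟩ := Nat.exists_eq_add_of_le hgd
  -- `X^k g ∈ S` for `k ≤ m`
  have hpow : ∀ k, k ≤ m → X ^ k * g ∈ S := by
    intro k
    induction k with
    | zero =>
      intro _
      simpa using hg
    | succ k ih =>
      intro hk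
      have hk' : X ^ k * g ∈ S := ih (by omega)
      have hne0 : X ^ k * g ≠ 0 := mul_ne_zero (pow_ne_zero _ X_ne_zero) hg0
      have hne : X * (X ^ k * g) ≠ 0 := mul_ne_zero X_ne_zero hne0
      have hdeg : (X * (X ^ k * g)).natDegree = g.natDegree + k + 1 := by
        rw [natDegree_X_mul hne0, natDegree_X_pow_mul k hg0]
      have hmem : X * (X ^ k * g) ∈ Polynomial.degreeLT ℂ (d + 1) :=
        (hclR_mem_degreeLT_iff_natDegree_lt hne).mpr (by omega)
      have := hclR_X_mul_mem_of_degree_lt S h hSd ht htd hk' hmem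
      rwa [← mul_assoc, ← pow_succ'] at this
  -- `W := g • degreeLT (m+1) ≤ S`
  have hWS : Submodule.map (LinearMap.mulLeft ℂ g) (Polynomial.degreeLT ℂ (m + 1)) ≤ S := by
    rw [Polynomial.degreeLT_eq_span_X_pow, Submodule.map_span, Submodule.span_le]
    rintro _ ⟨x, hx, rfl⟩
    obtain ⟨k, hk, rfl⟩ := Finset.mem_image.mp (Finset.mem_coe.mp hx)
    have hk' : k ≤ m := by
      have := Finset.mem_range.mp hk
      omega
    simp only [SetLike.mem_coe, LinearMap.mulLeft_apply]
    rw [mul_comm]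
    exact hpow k hk'
  -- `dim W = m + 1`
  have hinj : Function.Injective (LinearMap.mulLeft ℂ g) := fun x y hxy =>
    mul_left_cancel₀ hg0 (by simpa [LinearMap.mulLeft_apply] using hxy)
  have hfin := fun n => (hclR_finrank_degreeLT n).1
  have hdeg := fun n => (hclR_finrank_degreeLT n).2
  have hW : Module.finrank ℂ
      ↥(Submodule.map (LinearMap.mulLeft ℂ g) (Polynomial.degreeLT ℂ (m + 1))) = m + 1 := by
    rw [← (Submodule.equivMapOfInjective _ hinj _).finrank_eq, hdeg]
  -- `dim S ≤ m + 1`, since `S ∩ degreeLT (deg g) = 0` and `S + degreeLT (deg g) ≤ degreeLT (d+1)`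
  have hinf : S ⊓ Polynomial.degreeLT ℂ g.natDegree = ⊥ := by
    rw [eq_bot_iff]
    rintro p ⟨hp, hpd⟩
    rw [Submodule.mem_bot]
    by_contra hp0
    have := (hclR_mem_degreeLT_iff_natDegree_lt hp0).mp hpd
    have := hmin p hp hp0
    omega
  have hsup : S ⊔ Polynomial.degreeLT ℂ g.natDegree ≤ Polynomial.degreeLT ℂ (d + 1) :=
    sup_le hSd (Polynomial.degreeLT_mono (by omega))
  have hS_le : Module.finrank ℂ S ≤ m + 1 := by
    have h1 := Submodule.finrank_sup_add_finrank_inf_eq S (Polynomial.degreeLT ℂ g.natDegree)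
    rw [hinf, finrank_bot, hdeg] at h1
    have h2 := Submodule.finrank_mono hsup
    rw [hdeg] at h2
    omega
  -- conclude by dimension
  have hEq : Submodule.map (LinearMap.mulLeft ℂ g) (Polynomial.degreeLT ℂ (m + 1)) = S :=
    Submodule.eq_of_le_of_finrank_le hWS (hS_le.trans_eq hW.symm)
  have hfinS : Module.finrank ℂ S = m + 1 := by
    have := Submodule.finrank_mono hWS
    rw [hW] at this
    omega
  refine ⟨g, hg0, ?_⟩
  rw [hfinS]
  exact hEq.symm

end Summit.MatrixMultiplication.MatrixMultiplication.Theorems
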